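import Summits.NavierStokesRegularity.FluidComputer.PalasekTowerGermHostSuperposedFreeRunTools
import Summits.NavierStokesRegularity.FluidComputer.PalasekTowerBurgersLayerRobust
import Literature.Analysis.FluidPDE.LoopCirculation

/-!
# The germ host, superposition door — face transfer: the strain and the core read-outs of an amplifier
# pass to a field sup-close to `carrier + amplifier(· − c)` at translated points

Cell `ns-blowup`, seat `ns-blowup-ecbridge-3` (g7; D-0074 GROUP C «BRIDGE SUPPORT», lineage
`host_preparation`; bears_on LADDER-NS N1, route `PalasekTowerBreakdown`, crux `EpisodeBase` = item
stmt-NavierStokesRegularity-19179). LABEL: E–C typing (theorems only; no definition, no named fact, no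
`sorry`). WHAT THIS IS NOT: not Navier–Stokes evidence — calculus on three GIVEN fields at one instant.
Consumer: the superposition door `LevelZeroData.exists_superposed_freeRun`.

* `strain_face_transfer` — if `‖u − (r + g(· − c))‖ ≤ θ` everywhere, `‖r‖ ≤ η_t` on `B̄(x + c, h)`,
  `‖D²u‖, ‖D²g‖ ≤ K` and `2(θ + η_t)/h + 2K h ≤ η/2`, then `A + η ≤ ‖Dg(x)‖` gives `A + η/2 ≤ ‖Du(x + c)‖`
  (local Landau on `u − g(· − c)`).
* `core_face_transfer` — if moreover `‖r‖ ≤ η_t` along the translated loop `γ + c`, `‖γ′‖ ≤ L` and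
  `(η_t + θ) L ≤ η/2`, then `B + η ≤ circulation g γ` gives `B + η/2 ≤ circulation u (γ + c)`.

References: G. H. Hardy, J. E. Littlewood, G. Pólya, *Inequalities* §8 [cite: HardyLittlewoodPolya1952, §8 (Landau's inequality)];
S. Palasek, arXiv:2605.13827 §4 [cite: Palasek2026ElementaryModel, §4].
-/

noncomputable section

namespace Summit.NavierStokesRegularity.FluidComputer.PalasekTowerClayBridge.Germ

open Set Function Filter Topology Metric
open scoped Topology ContDiff
open Literature.Analysis Literature.Analysis.FluidPDE

variable {u g r : EuclideanSpace ℝ (Fin 3) → EuclideanSpace ℝ (Fin 3)} {c x : EuclideanSpace ℝ (Fin 3)}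

/-- **Strain face transfer.** Let `u, g` be `C²` with `‖D²u‖, ‖D²g‖ ≤ K`, `‖u(z) − (r(z) + g(z − c))‖ ≤ θ`
for all `z`, `‖r(z)‖ ≤ η_t` on `B̄(x + c, h)` (`h > 0`), and `2(θ + η_t)/h + (K + K) h ≤ η/2`. If
`A + η ≤ ‖Dg(x)‖` then `A + η/2 ≤ ‖Du(x + c)‖` (Landau's inequality on the ball for `u − g(· − c)`).
[cite: HardyLittlewoodPolya1952, §8 (Landau's inequality)] -/
theorem strain_face_transfer (hu : ContDiff ℝ 2 u) (hg : ContDiff ℝ 2 g) {θ ηt h K η A : ℝ} (hh : 0 < h)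
    (hclose : ∀ z, ‖u z - (r z + g (z - c))‖ ≤ θ) (htail : ∀ z ∈ closedBall (x + c) h, ‖r z‖ ≤ ηt)
    (hKu : ∀ z, ‖iteratedFDeriv ℝ 2 u z‖ ≤ K) (hKg : ∀ z, ‖iteratedFDeriv ℝ 2 g z‖ ≤ K)
    (herr : 2 * (θ + ηt) / h + (K + K) * h ≤ η / 2) (hst : A + η ≤ ‖fderiv ℝ g x‖) :
    A + η / 2 ≤ ‖fderiv ℝ u (x + c)‖ := by
  have hgc : ContDiff ℝ 2 (fun y => g (y - c)) := hg.comp (contDiff_id.sub contDiff_const)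
  set f : EuclideanSpace ℝ (Fin 3) → EuclideanSpace ℝ (Fin 3) := fun y => u y - g (y - c) with hf_def
  have hf2 : ContDiff ℝ 2 f := hu.sub hgc
  -- `‖f‖ ≤ θ + ηt` on the ball
  have hfball : ∀ z ∈ closedBall (x + c) h, ‖f z‖ ≤ θ + ηt := by
    intro z hz
    calc ‖f z‖ = ‖(u z - (r z + g (z - c))) + r z‖ := by rw [hf_def]; congr 1; abel
      _ ≤ ‖u z - (r z + g (z - c))‖ + ‖r z‖ := norm_add_le _ _
      _ ≤ θ + ηt := add_le_add (hclose z) (htail z hz)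
  -- `‖D²f‖ ≤ K + K`
  have hfD2 : ∀ z, ‖iteratedFDeriv ℝ 2 f z‖ ≤ K + K := by
    intro z
    have hsub : iteratedFDeriv ℝ 2 f z = iteratedFDeriv ℝ 2 u z - iteratedFDeriv ℝ 2 (fun y => g (y - c)) z := by
      have := iteratedFDeriv_sub_apply (𝕜 := ℝ) (f := u) (g := fun y => g (y - c)) (i := 2)
        (hu.contDiffAt.of_le le_rfl) (hgc.contDiffAt.of_le le_rfl) (x := z)
      exact this
    have htr : iteratedFDeriv ℝ 2 (fun y => g (y - c)) z = iteratedFDeriv ℝ 2 g (z - c) := by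
      rw [iteratedFDeriv_comp_sub']
    rw [hsub, htr]
    exact (norm_sub_le _ _).trans (add_le_add (hKu z) (hKg (z - c)))
  have hLandau := norm_fderiv_le_of_norm_le_on_ball hf2 hh hfball hfD2
  -- `Df(x + c) = Du(x + c) − Dg(x)`
  have hdf : fderiv ℝ f (x + c) = fderiv ℝ u (x + c) - fderiv ℝ g x := by
    have hd1 : HasFDerivAt u (fderiv ℝ u (x + c)) (x + c) := ((hu.differentiable (by norm_num)) _).hasFDerivAt
    have hd2 : HasFDerivAt (fun y => g (y - c)) (fderiv ℝ g x) (x + c) := by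
      rw [hasFDerivAt_comp_sub, add_sub_cancel_right]
      exact ((hg.differentiable (by norm_num)) x).hasFDerivAt
    rw [hf_def]
    exact (hd1.sub hd2).fderiv
  rw [hdf] at hLandau
  have h3 : ‖fderiv ℝ g x‖ ≤ ‖fderiv ℝ u (x + c)‖ + ‖fderiv ℝ u (x + c) - fderiv ℝ g x‖ := by
    calc ‖fderiv ℝ g x‖ = ‖fderiv ℝ u (x + c) - (fderiv ℝ u (x + c) - fderiv ℝ g x)‖ := by
          rw [sub_sub_cancel]
      _ ≤ _ := norm_sub_le _ _
  linarith

/-- **Core face transfer.** Let `u, g, r` be continuous with `‖u(z) − (r(z) + g(z − c))‖ ≤ θ` for all `z`,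
`γ` a `C¹` curve with `‖γ′‖ ≤ L` on `[0, 1]` (`L ≥ 0`) along whose translate `‖r(γ(s) + c)‖ ≤ η_t`, and
`η_t L + θ L ≤ η/2`. If `B + η ≤ circulation g γ` then `B + η/2 ≤ circulation u (γ + c)` (the translate reads
`g` on `γ`, the carrier and the error contribute at most `(η_t + θ) L`). [cite: Palasek2026ElementaryModel, §4] -/
theorem core_face_transfer (hu : Continuous u) (hg : Continuous g) (hr : Continuous r)
    {γ : ℝ → EuclideanSpace ℝ (Fin 3)} (hγ : ContDiff ℝ 1 γ) {θ ηt L η B : ℝ} (hL : 0 ≤ L)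
    (hγspeed : ∀ s ∈ Icc (0 : ℝ) 1, ‖deriv γ s‖ ≤ L)
    (hclose : ∀ z, ‖u z - (r z + g (z - c))‖ ≤ θ) (htail : ∀ s ∈ Icc (0 : ℝ) 1, ‖r (γ s + c)‖ ≤ ηt)
    (h3 : ηt * L + θ * L ≤ η / 2) (hcirc : B + η ≤ circulation g γ) :
    B + η / 2 ≤ circulation u (fun s => γ s + c) := by
  have _ := hL
  have hgc : Continuous (fun y => g (y - c)) := hg.comp (continuous_id.sub continuous_const)
  have hγ' : ContDiff ℝ 1 (fun s => γ s + c) := hγ.add contDiff_const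
  have hγ'speed : ∀ s ∈ Icc (0 : ℝ) 1, ‖deriv (fun s => γ s + c) s‖ ≤ L := fun s hs => by
    rw [deriv_add_const]; exact hγspeed s hs
  -- `circ u ≥ circ (r + g(· − c)) − θ L`
  have hscont : Continuous (fun y => r y + g (y - c)) := hr.add hgc
  have hnear : ∀ s ∈ Icc (0 : ℝ) 1,
      ‖u ((fun s => γ s + c) s) - (fun y => r y + g (y - c)) ((fun s => γ s + c) s)‖ ≤ θ :=
    fun s _ => hclose (γ s + c)
  have h1 := circulation_sub_le_of_near hscont hu hγ' hγ'speed hnear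
  -- `circ (r + g(· − c)) = circ r + circ g(· − c)` and the translate reads `g` on `γ`
  have hsplit : circulation (fun y => r y + g (y - c)) (fun s => γ s + c) =
      circulation r (fun s => γ s + c) + circulation (fun y => g (y - c)) (fun s => γ s + c) := by
    have := circulation_add_left (γ := fun s => γ s + c) hr hgc hγ'
    exact this
  have htrans : circulation (fun y => g (y - c)) (fun s => γ s + c) = circulation g γ := by
    rw [circulation_loop_add_const]
    simp only [add_sub_cancel_right]
  -- `circ r ≥ −ηt L` on the translated loop
  have hnear₁ : ∀ s ∈ Icc (0 : ℝ) 1,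
      ‖r ((fun s => γ s + c) s) - (0 : EuclideanSpace ℝ (Fin 3) → EuclideanSpace ℝ (Fin 3))
        ((fun s => γ s + c) s)‖ ≤ ηt := fun s hs => by
    simp only [Pi.zero_apply, sub_zero]
    exact htail s hs
  have h2 := circulation_sub_le_of_near continuous_zero hr hγ' hγ'speed hnear₁
  rw [circulation_zero_left] at h2
  rw [hsplit, htrans] at h1
  linarith

end Summit.NavierStokesRegularity.FluidComputer.PalasekTowerClayBridge.Germ

end
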